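import Summits.QuantumFields.QCD.Theses.HeatSlicedQuarks
import Summits.QuantumFields.QCD.Theorems.HeatSlicedQuarksQuarkLoopCoefficientDefs
import Summits.QuantumFields.QCD.Theorems.HeatSlicedQuarksDaviesGaffneyWilsonRange

/-!
# Exponential-series heat kernels on `ℤ⁴` (line `Sketch` of crux stmt-QuantumFields-16786, shared layer)

For a complex link field `u` on `ℤ⁴` with `‖u e‖ ≤ 1` (the unimodular fields of the line), the abelian
Wilson kernels of `HeatSlicedQuarksQuarkLoopCoefficientDefs` satisfy:

* support and entry bounds: `diracKer u x y = 0` unless `y ∈ nbr x`, `sqKer u x y = 0` unless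
  `y ∈ nbr2 x`, `‖diracKer u x y α β‖ ≤ 12`, `‖sqKer u x y α β‖ ≤ K_H`;
* kernel powers: the right recursion `sqKerPow u (n+1) x y = Σ_{z ∈ nbr2 y} sqKerPow u n x z * sqKer u z y`
  and the geometric bound `‖sqKerPow u n x y α β‖ ≤ Rⁿ`;
* the exponential series `heatKer u t x y = Σₙ (−t)ⁿ/n! Hⁿ(x,y)`: entrywise `HasSum`, value `δ` at `t = 0`,
  and the two heat equations `∂_t K = −H K = −K H` as entrywise `HasDerivAt` statements (termwise
  differentiation of a power series with infinite radius).

Pure algebra + elementary series estimates; Mathlib + the Defs file + `norm_euclideanGamma_apply_le`.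
-/

noncomputable section

namespace Summit.QuantumFields.QCD.Cruxes.QuarkLoopCoefficient.Sketch.HeatSeries

open Literature.MathematicalPhysics.QuantumLattice Literature.MathematicalPhysics.QuantumFieldTheory
open Literature.Probability.LatticeModels (Site)
open Summit.QuantumFields.QCD.Theorems.QuarkLoopCoefficient
open scoped Matrix ComplexConjugate

/-! ## §1 Neighbourhoods -/

/-- Membership in the range-one neighbourhood. -/
theorem mem_nbr {x y : Site 4} :
    y ∈ nbr x ↔ y = x ∨ ∃ μ : Fin 4, y = x + Pi.single μ 1 ∨ y = x - Pi.single μ 1 := by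
  simp only [nbr, Finset.mem_insert, Finset.mem_biUnion, Finset.mem_univ, true_and,
    Finset.mem_singleton]

/-- `x ∈ nbr x`. -/
theorem self_mem_nbr (x : Site 4) : x ∈ nbr x := mem_nbr.mpr (Or.inl rfl)

/-- `x + e_μ ∈ nbr x`. -/
theorem add_single_mem_nbr (x : Site 4) (μ : Fin 4) : x + Pi.single μ 1 ∈ nbr x :=
  mem_nbr.mpr (Or.inr ⟨μ, Or.inl rfl⟩)

/-- `x - e_μ ∈ nbr x`. -/
theorem sub_single_mem_nbr (x : Site 4) (μ : Fin 4) : x - Pi.single μ 1 ∈ nbr x :=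
  mem_nbr.mpr (Or.inr ⟨μ, Or.inr rfl⟩)

/-- The range-one neighbourhood is symmetric. -/
theorem mem_nbr_comm {x y : Site 4} : y ∈ nbr x ↔ x ∈ nbr y := by
  constructor <;> intro h <;> rcases mem_nbr.mp h with h | ⟨μ, h | h⟩
  · exact mem_nbr.mpr (Or.inl h.symm)
  · exact mem_nbr.mpr (Or.inr ⟨μ, Or.inr (by rw [h]; simp)⟩)
  · exact mem_nbr.mpr (Or.inr ⟨μ, Or.inl (by rw [h]; simp)⟩)
  · exact mem_nbr.mpr (Or.inl h.symm)
  · exact mem_nbr.mpr (Or.inr ⟨μ, Or.inr (by rw [h]; simp)⟩)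
  · exact mem_nbr.mpr (Or.inr ⟨μ, Or.inl (by rw [h]; simp)⟩)

/-- Membership in the range-two neighbourhood. -/
theorem mem_nbr2 {x y : Site 4} : y ∈ nbr2 x ↔ ∃ z ∈ nbr x, y ∈ nbr z := by
  simp only [nbr2, Finset.mem_biUnion]

/-- `nbr x ⊆ nbr2 x`. -/
theorem nbr_subset_nbr2 (x : Site 4) : nbr x ⊆ nbr2 x := fun _ hy =>
  mem_nbr2.mpr ⟨x, self_mem_nbr x, hy⟩

/-- `x ∈ nbr2 x`. -/
theorem self_mem_nbr2 (x : Site 4) : x ∈ nbr2 x := nbr_subset_nbr2 x (self_mem_nbr x)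

/-- The range-two neighbourhood is symmetric. -/
theorem mem_nbr2_comm {x y : Site 4} : y ∈ nbr2 x ↔ x ∈ nbr2 y := by
  constructor <;> intro h <;> obtain ⟨z, hz, hyz⟩ := mem_nbr2.mp h <;>
    exact mem_nbr2.mpr ⟨z, mem_nbr_comm.mp hyz, mem_nbr_comm.mp hz⟩

/-- `(nbr x).card ≤ 9`. -/
theorem card_nbr_le (x : Site 4) : (nbr x).card ≤ 9 := by
  unfold nbr
  refine (Finset.card_insert_le _ _).trans ?_
  have : (Finset.univ.biUnion fun μ : Fin 4 => ({x + Pi.single μ 1, x - Pi.single μ 1} : Finset (Site 4))).card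
      ≤ ∑ _μ : Fin 4, 2 :=
    Finset.card_biUnion_le.trans (Finset.sum_le_sum fun μ _ => Finset.card_le_two)
  have h8 : (Finset.univ.biUnion fun μ : Fin 4 =>
      ({x + Pi.single μ 1, x - Pi.single μ 1} : Finset (Site 4))).card ≤ 8 := by simpa using this
  omega

/-- `(nbr2 x).card ≤ 81`. -/
theorem card_nbr2_le (x : Site 4) : (nbr2 x).card ≤ 81 := by
  unfold nbr2
  refine Finset.card_biUnion_le.trans ?_
  calc ∑ z ∈ nbr x, (nbr z).card ≤ ∑ _z ∈ nbr x, 9 := Finset.sum_le_sum fun z _ => card_nbr_le z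
    _ = 9 * (nbr x).card := by rw [Finset.sum_const, smul_eq_mul, mul_comm]
    _ ≤ 9 * 9 := Nat.mul_le_mul_left 9 (card_nbr_le x)

/-! ## §2 Support and entry bounds of the Dirac and squared kernels -/

variable {u : LGConfig 4 ℂ}

/-- Off the range-one neighbourhood the Dirac kernel vanishes. -/
theorem diracKer_eq_zero {x y : Site 4} (h : y ∉ nbr x) : diracKer u x y = 0 := by
  have hxy : x ≠ y := fun e => h (mem_nbr.mpr (Or.inl e.symm))
  have hfw : ∀ μ : Fin 4, y ≠ x + Pi.single μ 1 := fun μ e => h (mem_nbr.mpr (Or.inr ⟨μ, Or.inl e⟩))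
  have hbw : ∀ μ : Fin 4, x ≠ y + Pi.single μ 1 := fun μ e =>
    h (mem_nbr.mpr (Or.inr ⟨μ, Or.inr (by rw [e]; simp)⟩))
  unfold diracKer
  simp [hxy, hfw, hbw]

/-- Entries of `1 ∓ γ_μ` are bounded by `2`. -/
theorem norm_one_sub_gamma_le (μ α β : Fin 4) : ‖((1 : Spin) - euclideanGamma μ) α β‖ ≤ 2 := by
  rw [Matrix.sub_apply]
  refine (norm_sub_le _ _).trans ?_
  have h1 : ‖(1 : Spin) α β‖ ≤ 1 := by
    rw [Matrix.one_apply]; split_ifs <;> simp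
  have h2 := Summit.QuantumFields.QCD.Theorems.HeatSlicedQuarksDaviesGaffney.norm_euclideanGamma_apply_le μ α β
  linarith

/-- Entries of `1 + γ_μ` are bounded by `2`. -/
theorem norm_one_add_gamma_le (μ α β : Fin 4) : ‖((1 : Spin) + euclideanGamma μ) α β‖ ≤ 2 := by
  rw [Matrix.add_apply]
  refine (norm_add_le _ _).trans ?_
  have h1 : ‖(1 : Spin) α β‖ ≤ 1 := by
    rw [Matrix.one_apply]; split_ifs <;> simp
  have h2 := Summit.QuantumFields.QCD.Theorems.HeatSlicedQuarksDaviesGaffney.norm_euclideanGamma_apply_le μ α β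
  linarith

/-- Entry bound of the Dirac kernel for a sub-unimodular link field: `‖D(x,y)_{αβ}‖ ≤ 12`. -/
theorem norm_diracKer_le (hu : ∀ e, ‖u e‖ ≤ 1) (x y : Site 4) (α β : Fin 4) :
    ‖diracKer u x y α β‖ ≤ 12 := by
  unfold diracKer
  rw [Matrix.sub_apply]
  refine (norm_sub_le _ _).trans ?_
  have hdiag : ‖(if x = y then (4 : ℂ) • (1 : Spin) else 0) α β‖ ≤ 4 := by
    split_ifs
    · rw [Matrix.smul_apply, smul_eq_mul, norm_mul, Matrix.one_apply]
      split_ifs <;> simp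
    · simp
  have hhop : ‖((1 / 2 : ℂ) • ∑ μ : Fin 4,
      ((if y = x + Pi.single μ 1 then u (x, μ) • ((1 : Spin) - euclideanGamma μ) else 0) +
        (if x = y + Pi.single μ 1 then conj (u (y, μ)) • ((1 : Spin) + euclideanGamma μ) else 0))) α β‖ ≤ 8 := by
    rw [Matrix.smul_apply, smul_eq_mul, norm_mul]
    have hhalf : ‖(1 / 2 : ℂ)‖ = 1 / 2 := by simp
    rw [hhalf]
    have hsum : ‖(∑ μ : Fin 4,
        ((if y = x + Pi.single μ 1 then u (x, μ) • ((1 : Spin) - euclideanGamma μ) else 0) +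
          (if x = y + Pi.single μ 1 then conj (u (y, μ)) • ((1 : Spin) + euclideanGamma μ) else 0))) α β‖ ≤
        ∑ _μ : Fin 4, (4 : ℝ) := by
      rw [Matrix.sum_apply]
      refine (norm_sum_le _ _).trans (Finset.sum_le_sum fun μ _ => ?_)
      rw [Matrix.add_apply]
      refine (norm_add_le _ _).trans ?_
      have t1 : ‖(if y = x + Pi.single μ 1 then u (x, μ) • ((1 : Spin) - euclideanGamma μ) else 0) α β‖ ≤ 2 := by
        split_ifs
        · rw [Matrix.smul_apply, smul_eq_mul, norm_mul]
          calc ‖u (x, μ)‖ * ‖((1 : Spin) - euclideanGamma μ) α β‖ ≤ 1 * 2 :=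
                mul_le_mul (hu _) (norm_one_sub_gamma_le μ α β) (norm_nonneg _) zero_le_one
            _ = 2 := by ring
        · simp
      have t2 : ‖(if x = y + Pi.single μ 1 then conj (u (y, μ)) • ((1 : Spin) + euclideanGamma μ) else 0) α β‖ ≤ 2 := by
        split_ifs
        · rw [Matrix.smul_apply, smul_eq_mul, norm_mul, RCLike.norm_conj]
          calc ‖u (y, μ)‖ * ‖((1 : Spin) + euclideanGamma μ) α β‖ ≤ 1 * 2 :=
                mul_le_mul (hu _) (norm_one_add_gamma_le μ α β) (norm_nonneg _) zero_le_one
            _ = 2 := by ring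
        · simp
      linarith
    have : ∑ _μ : Fin 4, (4 : ℝ) = 16 := by simp; norm_num
    rw [this] at hsum
    linarith
  linarith

/-- Off the range-two neighbourhood the squared kernel vanishes. -/
theorem sqKer_eq_zero {x y : Site 4} (h : y ∉ nbr2 x) : sqKer u x y = 0 := by
  unfold sqKer
  refine Finset.sum_eq_zero fun z hz => ?_
  have hy : y ∉ nbr z := fun hyz => h (mem_nbr2.mpr ⟨z, hz, hyz⟩)
  rw [diracKer_eq_zero hy, Matrix.mul_zero]

/-- Entry bound of the squared kernel: `‖H(x,y)_{αβ}‖ ≤ 5184`. -/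
theorem norm_sqKer_le (hu : ∀ e, ‖u e‖ ≤ 1) (x y : Site 4) (α β : Fin 4) :
    ‖sqKer u x y α β‖ ≤ 5184 := by
  unfold sqKer
  rw [Matrix.sum_apply]
  refine (norm_sum_le _ _).trans ?_
  have hterm : ∀ z ∈ nbr x, ‖((diracKer u z x)ᴴ * diracKer u z y) α β‖ ≤ 576 := by
    intro z _
    rw [Matrix.mul_apply]
    refine (norm_sum_le _ _).trans ?_
    calc ∑ γ : Fin 4, ‖(diracKer u z x)ᴴ α γ * diracKer u z y γ β‖
        ≤ ∑ _γ : Fin 4, (12 * 12 : ℝ) := Finset.sum_le_sum fun γ _ => by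
          rw [norm_mul, Matrix.conjTranspose_apply, norm_star]
          exact mul_le_mul (norm_diracKer_le hu z x γ α) (norm_diracKer_le hu z y γ β)
            (norm_nonneg _) (by norm_num)
      _ = 576 := by simp; norm_num
  calc ∑ z ∈ nbr x, ‖((diracKer u z x)ᴴ * diracKer u z y) α β‖
      ≤ ∑ _z ∈ nbr x, (576 : ℝ) := Finset.sum_le_sum hterm
    _ = 576 * (nbr x).card := by rw [Finset.sum_const, nsmul_eq_mul, mul_comm]
    _ ≤ 576 * 9 := by
        have := card_nbr_le x
        exact mul_le_mul_of_nonneg_left (by exact_mod_cast this) (by norm_num)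
    _ = 5184 := by norm_num

/-! ## §3 Kernel powers -/

/-- The geometric ratio of the power bound: `R = 81 · 4 · 5184`. -/
theorem powBound_def : (1679616 : ℝ) = 81 * 4 * 5184 := by norm_num

/-- Off the range-`2n` region the kernel powers vanish: if `y` is not reachable from `x` by `n` steps of
`nbr2`, then `Hⁿ(x,y) = 0`.  We only need the `n = 0` case explicitly: `H⁰(x,y) = 0` for `y ≠ x`. -/
theorem sqKerPow_zero_apply (x y : Site 4) :
    sqKerPow u 0 x y = if x = y then 1 else 0 := rfl

/-- The defining (left) recursion. -/
theorem sqKerPow_succ (n : ℕ) (x y : Site 4) :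
    sqKerPow u (n + 1) x y = ∑ z ∈ nbr2 x, sqKer u x z * sqKerPow u n z y := rfl

/-- Geometric entry bound of the kernel powers: `‖Hⁿ(x,y)_{αβ}‖ ≤ Rⁿ` with `R = 1679616`. -/
theorem norm_sqKerPow_le (hu : ∀ e, ‖u e‖ ≤ 1) :
    ∀ (n : ℕ) (x y : Site 4) (α β : Fin 4), ‖sqKerPow u n x y α β‖ ≤ (1679616 : ℝ) ^ n := by
  intro n
  induction n with
  | zero =>
    intro x y α β
    rw [sqKerPow_zero_apply, pow_zero]
    split_ifs
    · rw [Matrix.one_apply]; split_ifs <;> simp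
    · simp
  | succ n ih =>
    intro x y α β
    rw [sqKerPow_succ, Matrix.sum_apply]
    refine (norm_sum_le _ _).trans ?_
    have hterm : ∀ z ∈ nbr2 x, ‖(sqKer u x z * sqKerPow u n z y) α β‖ ≤ 4 * 5184 * 1679616 ^ n := by
      intro z _
      rw [Matrix.mul_apply]
      refine (norm_sum_le _ _).trans ?_
      calc ∑ γ : Fin 4, ‖sqKer u x z α γ * sqKerPow u n z y γ β‖
          ≤ ∑ _γ : Fin 4, (5184 : ℝ) * 1679616 ^ n := Finset.sum_le_sum fun γ _ => by
            rw [norm_mul]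
            exact mul_le_mul (norm_sqKer_le hu x z α γ) (ih z y γ β) (norm_nonneg _) (by norm_num)
        _ = 4 * 5184 * 1679616 ^ n := by simp; ring
    calc ∑ z ∈ nbr2 x, ‖(sqKer u x z * sqKerPow u n z y) α β‖
        ≤ ∑ _z ∈ nbr2 x, (4 * 5184 * (1679616 : ℝ) ^ n) := Finset.sum_le_sum hterm
      _ = (nbr2 x).card * (4 * 5184 * 1679616 ^ n) := by rw [Finset.sum_const, nsmul_eq_mul]
      _ ≤ 81 * (4 * 5184 * 1679616 ^ n) := by
          have := card_nbr2_le x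
          exact mul_le_mul_of_nonneg_right (by exact_mod_cast this) (by positivity)
      _ = 1679616 ^ (n + 1) := by rw [pow_succ]; ring

/-- A kernel sum over any finite set containing the support equals the sum over `nbr2`:
left version (`H(x,·)` supported in `nbr2 x`). -/
theorem sum_sqKer_mul_eq {S : Finset (Site 4)} {x : Site 4} (hS : nbr2 x ⊆ S) (F : Site 4 → Spin) :
    ∑ z ∈ S, sqKer u x z * F z = ∑ z ∈ nbr2 x, sqKer u x z * F z := by
  symm
  refine Finset.sum_subset hS fun z _ hz => ?_
  rw [sqKer_eq_zero hz, Matrix.zero_mul]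

/-- Right version: `H(·,y)` is supported in `nbr2 y` (symmetry of `nbr2`). -/
theorem sum_mul_sqKer_eq {S : Finset (Site 4)} {y : Site 4} (hS : nbr2 y ⊆ S) (F : Site 4 → Spin) :
    ∑ z ∈ S, F z * sqKer u z y = ∑ z ∈ nbr2 y, F z * sqKer u z y := by
  symm
  refine Finset.sum_subset hS fun z _ hz => ?_
  have : y ∉ nbr2 z := fun h => hz (mem_nbr2_comm.mp h)
  rw [sqKer_eq_zero this, Matrix.mul_zero]

/-- The right recursion of the kernel powers: `Hⁿ⁺¹(x,y) = Σ_{z ∈ nbr2 y} Hⁿ(x,z) H(z,y)`. -/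
theorem sqKerPow_succ_right :
    ∀ (n : ℕ) (x y : Site 4), sqKerPow u (n + 1) x y = ∑ z ∈ nbr2 y, sqKerPow u n x z * sqKer u z y := by
  intro n
  induction n with
  | zero =>
    intro x y
    rw [sqKerPow_succ]
    simp only [sqKerPow_zero_apply]
    -- left: Σ_{z ∈ nbr2 x} H(x,z) δ(z,y) ; right: Σ_{z ∈ nbr2 y} δ(x,z) H(z,y)
    have hl : ∑ z ∈ nbr2 x, sqKer u x z * (if z = y then (1 : Spin) else 0) =
        if y ∈ nbr2 x then sqKer u x y else 0 := by
      simp only [mul_ite, Matrix.mul_one, Matrix.mul_zero]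
      rw [Finset.sum_ite_eq' (nbr2 x) y]
    have hr : ∑ z ∈ nbr2 y, (if x = z then (1 : Spin) else 0) * sqKer u z y =
        if x ∈ nbr2 y then sqKer u x y else 0 := by
      simp only [ite_mul, Matrix.one_mul, Matrix.zero_mul]
      rw [Finset.sum_ite_eq (nbr2 y) x]
    rw [hl, hr]
    by_cases h : y ∈ nbr2 x
    · rw [if_pos h, if_pos (mem_nbr2_comm.mp h)]
    · rw [if_neg h, if_neg (fun h' => h (mem_nbr2_comm.mp h'))]
  | succ n ih =>
    intro x y
    rw [sqKerPow_succ]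
    conv_lhs => arg 2; ext z; rw [ih z y, Finset.mul_sum]
    rw [Finset.sum_comm]
    refine Finset.sum_congr rfl fun w _ => ?_
    rw [sqKerPow_succ, Finset.sum_mul]
    refine Finset.sum_congr rfl fun z _ => ?_
    rw [Matrix.mul_assoc]

/-! ## Registered headline -/

/-- Registered headline of this helper file (aux stub `stub_heatSeriesA` of crux stmt-QuantumFields-16786, line
`Sketch`; the stub registry is textual): the right recursion of the kernel powers. -/
theorem stub_heatSeriesA :
    ∀ (u : LGConfig 4 ℂ) (n : ℕ) (x y : Site 4),
      sqKerPow u (n + 1) x y = ∑ z ∈ nbr2 y, sqKerPow u n x z * sqKer u z y :=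
  fun _ n x y => sqKerPow_succ_right n x y

end Summit.QuantumFields.QCD.Cruxes.QuarkLoopCoefficient.Sketch.HeatSeries

end
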